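import Summits.BirchSwinnertonDyer.Rank1Residual.Additive.CyclotomicTowerLocalTorsionPadic
import Summits.BirchSwinnertonDyer.Rank1Residual.Additive.CyclotomicTowerSignedSelmerDual
import Literature.NumberTheory.EllipticCurves.GeomPointsGaloisModule
import Literature.NumberTheory.GaloisRepresentations.AbsGaloisGroupCompact
import Literature.NumberTheory.EllipticCurves.ZpExtensionPadicUnitsProofs
import HarnessLib

/-!
# `E(K_{∞,w})[p^∞] = 0`: Prop. 8.7 at the TOP of the tower `K₀·K_∞^κ` from the bottom layer
# `E(K_{0,v})[p] = 0` (and hence, at `E = ℚ_p` for good supersingular `p ≥ 3`, with no hypothesis) —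
# the vanishing `A(K_{∞,w}) = 0` behind the inflation–restriction step of the bottom-layer control
# (cell `b2b-bsdres`, CLASS-CLOSURE lane, class O10 — x1b GEN 32, class lead; file 10 of the local
# series p315764 / p316085 / p316474 / p316672 / p317003)

HONEST FRAMING (cell `b2b-bsdres`, run/shared/lean/b2b/bsd-rank1-residual/, verbatim in every
file): the goal of the cell is to DELETE the COMBINATION-SHAPED residual classes of the
Birch–Swinnerton-Dyer formula for ALL analytic-rank `≤ 1` elliptic curves over `ℚ` — "full BSD
formula for every rank `≤ 1` curve in class `C`" assembled STRICTLY from published theorems — so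
that the rank-`≤ 1` remainder becomes exactly the CONSTRUCTION-SHAPED classes, which are TYPED
(missing-input `Prop`s), NOT attempted. This is not "finishing BSD". CLASS-CLOSURE lane: prove
what is provable now; shrink each hard class to its core with data; no claim beyond stated classes;
research routes on CONSTRUCTION-SHAPED X12 / O10; census / instrument output = EVIDENCE / conjecture
items, NEVER a Literature fact; `RESIDUAL-MAP.md` marks change only by signed lines. THIS FILE:
TOOL THEOREMS ONLY (topology of the tower subgroups + a compactness argument) — no definition, no
named Literature fact, no Summits-side fact `def`, no `sorry`, axioms standard; nothing is booked;
no label / mark / count / sub-cell moves; O10 stays OPEN / CONSTRUCTION-SHAPED; nothing about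
`BSD(W, p)` of any pair is claimed.

## What is proved

* §1 `ZpExtension.iInf_layerSubgroup_eq_kerSubgroup` — `⋂ₙ κ⁻¹(pⁿℤ_p) = ker κ` (the tree's
  `ZpExtension.PadicUnits.eq_zero_of_forall_pow_dvd`); `iInf_towerSubgroup_eq_towerTopSubgroup` —
  `⋂ₙ Gal(K̄/K₀K_n) = Gal(K̄/K₀K_∞)`; `iInf_localSubgroupOfEmb_towerSubgroup` — the same for the local
  subgroups at an embedding `ι` (`Subgroup.comap_iInf`); `isClosed_localSubgroupOfEmb_towerSubgroup` (with the
  tree's `isClosed_galRange`, `CyclotomicTowerSignedSelmerDual`).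
* §2 **`exists_mem_localFixedPointsOfEmb_towerSubgroup_of_mem_towerTopSubgroup`** — a point of `E(K̄_E)`
  fixed by `Gal(K̄_E/K₀K_{∞,w})` is fixed by `Gal(K̄_E/K₀K_{n,w})` for some `n` (its stabiliser is OPEN,
  `isOpen_stabilizer_localPoints`; the closed subgroups `(towerSubgroup n)_E` decrease to
  `(towerTopSubgroup)_E` in the COMPACT group `Γ_E`, `IsCompact.elim_directed_family_closed`), i.e.
  `E(K_{∞,w}) = ⋃ₙ E(K_{n,w})`;
  **`eq_zero_of_prime_pow_smul_eq_zero_localFixedPointsOfEmb_towerTopSubgroup_of_galRange`** —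
  `E(K_{0,v})[p] = 0 ⟹ E(K_{∞,w})[p^∞] = 0` (file 5's layer-wise descent + §2).
* §3 at `E = ℚ_p`: **`eq_zero_of_prime_pow_smul_eq_zero_localFixedPointsOfEmb_towerTopSubgroup_padic`**
  — for `K₀/K` Galois of degree `< (p² − 1)/2`, `p ≥ 3`, `W` with a good supersingular `ℤ_p`-model:
  `E(K_{∞,w})[p^∞] = 0` with NO torsion hypothesis (file 6) — Kobayashi's `E(k_∞)[p^∞] = 0`
  (Prop. 8.7), the input `A(K_∞,w) = 0` of the inflation–restriction isomorphism
  `H¹(ℚ_p, W[p^∞]) ≅ H¹(k_∞, A)^{Γ}` in the bottom-layer control count (note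
  `class-closure/O10/C3ETA-TRANSVERSALITY-x1b.md` §1/§4).

References: [Kobayashi2003] §2 p. 4 (`K_∞`), Prop. 8.7 (p. 16); [GreenbergLNM1716] §3 (control via
inflation–restriction); [SerreGaloisCohomology1997] II.§1.1.
-/

noncomputable section

open scoped Classical

universe u

namespace Summit.BirchSwinnertonDyer.Rank1Residual.Additive

open Literature.NumberTheory.EllipticCurves Literature.NumberTheory.GaloisRepresentations
  Literature.NumberTheory.EllipticCurves.Kobayashi2003 ZpExtension

/-! ## §1 The tower subgroups decrease to the top subgroup; closedness -/

section Topology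

variable {K : Type u} [Field K] {p : ℕ} [hp : Fact p.Prime] (κ : ZpExtension K p)
  (K₀ : Type u) [Field K₀] [Algebra K K₀]
  {E : Type u} [Field E] [Algebra K E] (ι : AlgebraicClosure K →ₐ[K] AlgebraicClosure E)

/-- **`⋂ₙ κ⁻¹(pⁿℤ_p) = ker κ`**: `Gal(K̄/K_∞) = ⋂ₙ Gal(K̄/K_n)`. Washington, *Cyclotomic Fields*,
§13.1. [folklore] -/
theorem _root_.Literature.NumberTheory.EllipticCurves.ZpExtension.iInf_layerSubgroup_eq_kerSubgroup :
    ⨅ n, κ.layerSubgroup n = κ.kerSubgroup := by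
  refine le_antisymm (fun σ hσ ↦ ?_) (le_iInf fun n ↦ κ.kerSubgroup_le_layerSubgroup n)
  rw [Subgroup.mem_iInf] at hσ
  rw [mem_kerSubgroup]
  have h0 : (κ σ).toAdd = 0 :=
    ZpExtension.PadicUnits.eq_zero_of_forall_pow_dvd fun n ↦ mem_layerSubgroup.mp (hσ n)
  exact toAdd_eq_zero.mp h0

/-- **`⋂ₙ Gal(K̄/K₀K_n) = Gal(K̄/K₀K_∞)`** (`towerTopSubgroup`). [cite: Kobayashi2003, §2 p. 4 (K_∞ = ∪ K_n)] -/
theorem iInf_towerSubgroup_eq_towerTopSubgroup :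
    ⨅ n, towerSubgroup κ K₀ n = towerTopSubgroup κ K₀ := by
  change ⨅ n, κ.layerSubgroup n ⊓ galRange (K := K) K₀ = κ.kerSubgroup ⊓ galRange (K := K) K₀
  rw [iInf_inf_eq, κ.iInf_layerSubgroup_eq_kerSubgroup, iInf_const]

/-- The local subgroups at `ι` decrease to the local top subgroup:
`⋂ₙ (towerSubgroup n)_E = (towerTopSubgroup)_E` (`Subgroup.comap_iInf`). [cite: Kobayashi2003, §2 p. 4] -/
theorem iInf_localSubgroupOfEmb_towerSubgroup :
    ⨅ n, localSubgroupOfEmb (towerSubgroup κ K₀ n) ι = localSubgroupOfEmb (towerTopSubgroup κ K₀) ι := by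
  unfold localSubgroupOfEmb
  rw [← Subgroup.comap_iInf, iInf_towerSubgroup_eq_towerTopSubgroup]

/-- The local tower subgroups `(towerSubgroup n)_E ≤ Γ_E` are closed (preimages under the continuous
restriction of `κ⁻¹(pⁿℤ_p) ∩ Gal(K̄/K₀)`, open-hence-closed meet closed).
[cite: SerreGaloisCohomology1997, II.§1.1] -/
theorem isClosed_localSubgroupOfEmb_towerSubgroup [NumberField K₀] (n : ℕ) :
    IsClosed ((localSubgroupOfEmb (towerSubgroup κ K₀ n) ι : Subgroup (Field.absoluteGaloisGroup E)) :
      Set (Field.absoluteGaloisGroup E)) := by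
  have h1 : IsClosed ((κ.layerSubgroup n : Subgroup (Field.absoluteGaloisGroup K)) :
      Set (Field.absoluteGaloisGroup K)) :=
    (κ.layerSubgroup n).isClosed_of_isOpen (κ.isOpen_layerSubgroup n)
  have h2 := isClosed_galRange (K := K) K₀
  exact (h1.inter h2).preimage (map_continuous (resGalOfEmb ι))

end Topology

/-! ## §2 `E(K_{∞,w}) = ⋃ₙ E(K_{n,w})` and Prop. 8.7 at the top from the bottom -/

section Top

variable {K : Type u} [Field K] {p : ℕ} [hp : Fact p.Prime] (κ : ZpExtension K p)
  (K₀ : Type u) [Field K₀] [NumberField K₀] [Algebra K K₀]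
  {E : Type u} [Field E] [Algebra K E] [PerfectField E]
  (ι : AlgebraicClosure K →ₐ[K] AlgebraicClosure E) (W : WeierstrassCurve K)

/-- **`E(K_{∞,w}) = ⋃ₙ E(K_{n,w})`**: a point of `E(K̄_E)` fixed by `(towerTopSubgroup)_E` is fixed
by `(towerSubgroup n)_E` for some `n` — its stabiliser is open (`isOpen_stabilizer_localPoints`),
the `(towerSubgroup n)_E` are closed and decrease to `(towerTopSubgroup)_E`, and `Γ_E` is compact
(`IsCompact.elim_directed_family_closed`). [cite: Kobayashi2003, §2 p. 4 (K_∞ = ∪ K_n)] -/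
theorem exists_mem_localFixedPointsOfEmb_towerSubgroup_of_mem_towerTopSubgroup
    {Q : localPoints W E} (hQ : Q ∈ localFixedPointsOfEmb ι W (towerTopSubgroup κ K₀)) :
    ∃ n : ℕ, Q ∈ localFixedPointsOfEmb ι W (towerSubgroup κ K₀ n) := by
  haveI : CompactSpace (Field.absoluteGaloisGroup E) := compactSpace_absoluteGaloisGroup E
  set S : Set (Field.absoluteGaloisGroup E) :=
    ((MulAction.stabilizer (Field.absoluteGaloisGroup E) Q : Subgroup (Field.absoluteGaloisGroup E)) :
      Set (Field.absoluteGaloisGroup E)) with hS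
  have hSo : IsOpen S := W.isOpen_stabilizer_localPoints E Q
  set t : ℕ → Set (Field.absoluteGaloisGroup E) :=
    fun n ↦ (localSubgroupOfEmb (towerSubgroup κ K₀ n) ι : Set (Field.absoluteGaloisGroup E)) ∩ Sᶜ
    with ht
  have htc : ∀ n, IsClosed (t n) := fun n ↦
    (isClosed_localSubgroupOfEmb_towerSubgroup κ K₀ ι n).inter hSo.isClosed_compl
  have hanti : Antitone t := fun m n hmn ↦
    Set.inter_subset_inter_left _ (Subgroup.comap_mono (towerSubgroup_antitone κ K₀ hmn))
  have hdir : Directed (fun x1 x2 ↦ x1 ⊇ x2) t := hanti.directed_ge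
  -- the intersection of the `t n` is empty: `⋂ (towerSubgroup n)_E = (towerTop)_E ⊆ S`
  have hsub : ((localSubgroupOfEmb (towerTopSubgroup κ K₀) ι : Subgroup _) :
      Set (Field.absoluteGaloisGroup E)) ⊆ S := by
    intro τ hτ
    rw [mem_localFixedPointsOfEmb_iff] at hQ
    exact hQ τ hτ
  have hempty : Set.univ ∩ ⋂ n, t n = ∅ := by
    rw [Set.univ_inter, Set.eq_empty_iff_forall_notMem]
    intro τ hτ
    rw [Set.mem_iInter] at hτ
    have hmem : τ ∈ ((⨅ n, localSubgroupOfEmb (towerSubgroup κ K₀ n) ι : Subgroup _) :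
        Set (Field.absoluteGaloisGroup E)) := by
      rw [Subgroup.coe_iInf, Set.mem_iInter]
      exact fun n ↦ (hτ n).1
    rw [iInf_localSubgroupOfEmb_towerSubgroup] at hmem
    exact (hτ 0).2 (hsub hmem)
  obtain ⟨n, hn⟩ := isCompact_univ.elim_directed_family_closed t htc hempty hdir
  refine ⟨n, ?_⟩
  rw [mem_localFixedPointsOfEmb_iff]
  intro τ hτ
  by_contra hne
  have : τ ∈ Set.univ ∩ t n := ⟨Set.mem_univ _, hτ, hne⟩
  rw [hn] at this
  exact this

variable [W.IsElliptic] [(galRange (K := K) K₀).Normal]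

/-- **Prop. 8.7 at the top of the tower from its bottom**: `E(K_{0,v})[p] = 0 ⟹ E(K_{∞,w})[p^k] = 0`
for every `k` (the point lies in some `E(K_{n,w})`, §2, and file 5's descent applies there).
[cite: Kobayashi2003, Prop. 8.7 (p. 16)] -/
theorem eq_zero_of_prime_pow_smul_eq_zero_localFixedPointsOfEmb_towerTopSubgroup_of_galRange (k : ℕ)
    (h₀ : ∀ Q ∈ localFixedPointsOfEmb ι W (galRange (K := K) K₀), p • Q = 0 → Q = 0) :
    ∀ Q ∈ localFixedPointsOfEmb ι W (towerTopSubgroup κ K₀), p ^ k • Q = 0 → Q = 0 := by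
  intro Q hQ hpQ
  obtain ⟨n, hn⟩ :=
    exists_mem_localFixedPointsOfEmb_towerSubgroup_of_mem_towerTopSubgroup κ K₀ ι W hQ
  exact eq_zero_of_prime_pow_smul_eq_zero_localFixedPointsOfEmb_towerSubgroup_of_galRange κ K₀ ι W
    n k h₀ Q hn hpQ

end Top

/-! ## §3 At `E = ℚ_p`: `E(K_{∞,w})[p^∞] = 0` with no hypothesis (good supersingular `p ≥ 3`) -/

section Padic

variable {p : ℕ} [hp : Fact p.Prime] {K : Type} [Field K] [Algebra K ℚ_[p]] (κ : ZpExtension K p)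
  (K₀ : Type) [Field K₀] [NumberField K₀] [Algebra K K₀] [(galRange (K := K) K₀).Normal]
  (ι : AlgebraicClosure K →ₐ[K] AlgebraicClosure ℚ_[p]) (W : WeierstrassCurve K) [W.IsElliptic]

/-- **`E(K_{∞,w})[p^∞] = 0` at `E = ℚ_p`, DISCHARGED** (Kobayashi's Prop. 8.7 in its `k_∞` form): for
`K₀/K` Galois with `[Γ_K : Gal(K̄/K₀)]` finite and `< (p² − 1)/2`, `p ≥ 3`, and `W` with a good
supersingular `ℤ_p`-model `M` (`Δ(M)` a unit, `A_p(M) ∈ pℤ_p`, `M ⊗ ℚ̄_p = W ⊗ ℚ̄_p`): the points of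
`W(ℚ̄_p)` fixed by `Gal(ℚ̄_p/K₀K_{∞,w})` have no `p`-power torsion (§2 + file 6's
`eq_zero_of_prime_smul_eq_zero_localFixedPointsOfEmb_padic_of_normal`). This is the vanishing
`A(K_{∞,w}) = 0` that makes the inflation–restriction map of the bottom-layer control an
isomorphism. [cite: Kobayashi2003, Prop. 8.7 (p. 16)] -/
theorem eq_zero_of_prime_pow_smul_eq_zero_localFixedPointsOfEmb_towerTopSubgroup_padic (hp2 : p ≠ 2)
    (M : WeierstrassCurve ℤ_[p]) (hΔ : IsUnit M.Δ)
    (hA : M.hasseCoeff p ∈ IsLocalRing.maximalIdeal ℤ_[p])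
    (hWM : M.baseChange (AlgebraicClosure ℚ_[p]) = W.baseChange (AlgebraicClosure ℚ_[p]))
    (hK₀0 : (galRange (K := K) K₀).index ≠ 0) (hK₀ : (galRange (K := K) K₀).index < (p ^ 2 - 1) / 2)
    (k : ℕ) :
    ∀ Q ∈ localFixedPointsOfEmb ι W (towerTopSubgroup κ K₀), p ^ k • Q = 0 → Q = 0 :=
  eq_zero_of_prime_pow_smul_eq_zero_localFixedPointsOfEmb_towerTopSubgroup_of_galRange κ K₀ ι W k
    (eq_zero_of_prime_smul_eq_zero_localFixedPointsOfEmb_padic_of_normal ι W hp2 M hΔ hA hWM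
      (galRange (K := K) K₀) hK₀0 hK₀)

end Padic

end Summit.BirchSwinnertonDyer.Rank1Residual.Additive

end
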